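import Summits.Ventures.HSemireg.Pad4TowerLineDesignCert12Closure

/-!
# Pad4Tower ∕ LineDesignCert12 — KERNEL DECIDES (1∕7, `RuleD1`): RULE D (μ₄, M) at the `N`-heads of chunks 1–37 of 61

Tree cut of the KERNEL CERTIFICATE `Cert12`: the `decide +kernel` theorems of this module are, by NAME, STATEMENT and PROOF, those of the farm-certified
Cruxes-level parts `CeilingLineCert12A–E` (split5); the module boundary is set by the gate's build budget only. Each theorem is one static-family check at a few
heads of the design `cfg` of `Pad4TowerLineDesignCert12Closure`; the assembly is in `Pad4TowerLineDesignCert12`.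

MODULE SET (tree cut of ONE certificate; one namespace `Summit.Ventures.HSemireg.Pad4Tower.LineDesignCert12`): `…Cert12DataN` ∕ `DataP` ∕ `DataPd` ∕ `DataNd` (the support and its literal
dual-0 world, DATA ONLY) → `…Cert12Closure` (key-chain `Nodup`, the design `cfg`, the literal dual `cfgd` and `cfg_dual_eq`, ◇₁₂, the ceiling line, per-chunk
G₁ closure ⇒ `cfg` is Δ- and S₄-closed) → `…Cert12RuleD1` ∕ `…Cert12RuleD2` ∕ `…Cert12RuleD3` ∕ `…Cert12XPlus1` ∕ `…Cert12XPlus2` ∕ `…Cert12XPlus3` ∕ `…Cert12XPlus4` (the RULE D (μ₄, M) resp. guarded X⁺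
decides, a few heads per theorem, module boundaries set by the gate's build budget only) → `Pad4TowerLineDesignCert12` (assembly `cfg_staticH1` and the
UNCONDITIONAL doors `¬ SeedB1OddDiamondG1H1 12`, `¬ SeedB1OddConeG1H1`, `¬ SeedB1OddDiamondG1H1 h'` (12 ≤ h'), the LINE shape, every support cell's realisability).

NOTHING IN THIS MODULE SET SAYS THAT HC ∕ HC_CM ∕ HC_AV ∕ H2 ∕ stmt-HodgeConjecture-18881 HOLDS OR FAILS (HC_CM is a displayed binder of the
ladder only); the certified statements concern the typed FIRST-ORDER static game (`RuleDMu4Closed`, `XPlusClosed`, `A2IMinusClosed` = `MConfig.StaticH1`)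
of ONE explicit finite support — first order is necessary, not sufficient, for a seed; no σ, no seed, no census row. `decide +kernel` only: NO `native_decide`,
no `sorry`, no `axiom`, no `instance`, no notation, no Literature fact, no new `def … : Prop`.
-/

set_option linter.dupNamespace false

namespace Summit.Ventures.HSemireg.Pad4Tower.LineDesignCert12

open Summit.Ventures.HSemireg Summit.Ventures.HSemireg.Pad4Tower

set_option maxRecDepth 32768
set_option Elab.async false
set_option synthInstance.maxSize 8192
set_option synthInstance.maxHeartbeats 2000000
set_option maxHeartbeats 8000000

/-! RULE D (μ₄, M) at the `N`-cells, heads chunked (5 per theorem) -/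

/-- RULE D (μ₄, M) holds at the `N`-heads of chunk 1∕61. [kernel `decide`] -/
theorem ruleDN_1 : ∀ Z ∈ lN_1, RuleDMu4N cfg Z := by decide +kernel
/-- RULE D (μ₄, M) holds at the `N`-heads of chunk 2∕61. [kernel `decide`] -/
theorem ruleDN_2 : ∀ Z ∈ lN_2, RuleDMu4N cfg Z := by decide +kernel
/-- RULE D (μ₄, M) holds at the `N`-heads of chunk 3∕61. [kernel `decide`] -/
theorem ruleDN_3 : ∀ Z ∈ lN_3, RuleDMu4N cfg Z := by decide +kernel
/-- RULE D (μ₄, M) holds at the `N`-heads of chunk 4∕61. [kernel `decide`] -/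
theorem ruleDN_4 : ∀ Z ∈ lN_4, RuleDMu4N cfg Z := by decide +kernel
/-- RULE D (μ₄, M) holds at the `N`-heads of chunk 5∕61. [kernel `decide`] -/
theorem ruleDN_5 : ∀ Z ∈ lN_5, RuleDMu4N cfg Z := by decide +kernel
/-- RULE D (μ₄, M) holds at the `N`-heads of chunk 6∕61. [kernel `decide`] -/
theorem ruleDN_6 : ∀ Z ∈ lN_6, RuleDMu4N cfg Z := by decide +kernel
/-- RULE D (μ₄, M) holds at the `N`-heads of chunk 7∕61. [kernel `decide`] -/
theorem ruleDN_7 : ∀ Z ∈ lN_7, RuleDMu4N cfg Z := by decide +kernel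
/-- RULE D (μ₄, M) holds at the `N`-heads of chunk 8∕61. [kernel `decide`] -/
theorem ruleDN_8 : ∀ Z ∈ lN_8, RuleDMu4N cfg Z := by decide +kernel
/-- RULE D (μ₄, M) holds at the `N`-heads of chunk 9∕61. [kernel `decide`] -/
theorem ruleDN_9 : ∀ Z ∈ lN_9, RuleDMu4N cfg Z := by decide +kernel
/-- RULE D (μ₄, M) holds at the `N`-heads of chunk 10∕61. [kernel `decide`] -/
theorem ruleDN_10 : ∀ Z ∈ lN_10, RuleDMu4N cfg Z := by decide +kernel
/-- RULE D (μ₄, M) holds at the `N`-heads of chunk 11∕61. [kernel `decide`] -/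
theorem ruleDN_11 : ∀ Z ∈ lN_11, RuleDMu4N cfg Z := by decide +kernel
/-- RULE D (μ₄, M) holds at the `N`-heads of chunk 12∕61. [kernel `decide`] -/
theorem ruleDN_12 : ∀ Z ∈ lN_12, RuleDMu4N cfg Z := by decide +kernel
/-- RULE D (μ₄, M) holds at the `N`-heads of chunk 13∕61. [kernel `decide`] -/
theorem ruleDN_13 : ∀ Z ∈ lN_13, RuleDMu4N cfg Z := by decide +kernel
/-- RULE D (μ₄, M) holds at the `N`-heads of chunk 14∕61. [kernel `decide`] -/
theorem ruleDN_14 : ∀ Z ∈ lN_14, RuleDMu4N cfg Z := by decide +kernel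
/-- RULE D (μ₄, M) holds at the `N`-heads of chunk 15∕61. [kernel `decide`] -/
theorem ruleDN_15 : ∀ Z ∈ lN_15, RuleDMu4N cfg Z := by decide +kernel
/-- RULE D (μ₄, M) holds at the `N`-heads of chunk 16∕61. [kernel `decide`] -/
theorem ruleDN_16 : ∀ Z ∈ lN_16, RuleDMu4N cfg Z := by decide +kernel
/-- RULE D (μ₄, M) holds at the `N`-heads of chunk 17∕61. [kernel `decide`] -/
theorem ruleDN_17 : ∀ Z ∈ lN_17, RuleDMu4N cfg Z := by decide +kernel
/-- RULE D (μ₄, M) holds at the `N`-heads of chunk 18∕61. [kernel `decide`] -/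
theorem ruleDN_18 : ∀ Z ∈ lN_18, RuleDMu4N cfg Z := by decide +kernel
/-- RULE D (μ₄, M) holds at the `N`-heads of chunk 19∕61. [kernel `decide`] -/
theorem ruleDN_19 : ∀ Z ∈ lN_19, RuleDMu4N cfg Z := by decide +kernel
/-- RULE D (μ₄, M) holds at the `N`-heads of chunk 20∕61. [kernel `decide`] -/
theorem ruleDN_20 : ∀ Z ∈ lN_20, RuleDMu4N cfg Z := by decide +kernel
/-- RULE D (μ₄, M) holds at the `N`-heads of chunk 21∕61. [kernel `decide`] -/
theorem ruleDN_21 : ∀ Z ∈ lN_21, RuleDMu4N cfg Z := by decide +kernel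
/-- RULE D (μ₄, M) holds at the `N`-heads of chunk 22∕61. [kernel `decide`] -/
theorem ruleDN_22 : ∀ Z ∈ lN_22, RuleDMu4N cfg Z := by decide +kernel
/-- RULE D (μ₄, M) holds at the `N`-heads of chunk 23∕61. [kernel `decide`] -/
theorem ruleDN_23 : ∀ Z ∈ lN_23, RuleDMu4N cfg Z := by decide +kernel
/-- RULE D (μ₄, M) holds at the `N`-heads of chunk 24∕61. [kernel `decide`] -/
theorem ruleDN_24 : ∀ Z ∈ lN_24, RuleDMu4N cfg Z := by decide +kernel
/-- RULE D (μ₄, M) holds at the `N`-heads of chunk 25∕61. [kernel `decide`] -/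
theorem ruleDN_25 : ∀ Z ∈ lN_25, RuleDMu4N cfg Z := by decide +kernel
/-- RULE D (μ₄, M) holds at the `N`-heads of chunk 26∕61. [kernel `decide`] -/
theorem ruleDN_26 : ∀ Z ∈ lN_26, RuleDMu4N cfg Z := by decide +kernel
/-- RULE D (μ₄, M) holds at the `N`-heads of chunk 27∕61. [kernel `decide`] -/
theorem ruleDN_27 : ∀ Z ∈ lN_27, RuleDMu4N cfg Z := by decide +kernel
/-- RULE D (μ₄, M) holds at the `N`-heads of chunk 28∕61. [kernel `decide`] -/
theorem ruleDN_28 : ∀ Z ∈ lN_28, RuleDMu4N cfg Z := by decide +kernel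
/-- RULE D (μ₄, M) holds at the `N`-heads of chunk 29∕61. [kernel `decide`] -/
theorem ruleDN_29 : ∀ Z ∈ lN_29, RuleDMu4N cfg Z := by decide +kernel
/-- RULE D (μ₄, M) holds at the `N`-heads of chunk 30∕61. [kernel `decide`] -/
theorem ruleDN_30 : ∀ Z ∈ lN_30, RuleDMu4N cfg Z := by decide +kernel
/-- RULE D (μ₄, M) holds at the `N`-heads of chunk 31∕61. [kernel `decide`] -/
theorem ruleDN_31 : ∀ Z ∈ lN_31, RuleDMu4N cfg Z := by decide +kernel
/-- RULE D (μ₄, M) holds at the `N`-heads of chunk 32∕61. [kernel `decide`] -/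
theorem ruleDN_32 : ∀ Z ∈ lN_32, RuleDMu4N cfg Z := by decide +kernel
/-- RULE D (μ₄, M) holds at the `N`-heads of chunk 33∕61. [kernel `decide`] -/
theorem ruleDN_33 : ∀ Z ∈ lN_33, RuleDMu4N cfg Z := by decide +kernel
/-- RULE D (μ₄, M) holds at the `N`-heads of chunk 34∕61. [kernel `decide`] -/
theorem ruleDN_34 : ∀ Z ∈ lN_34, RuleDMu4N cfg Z := by decide +kernel
/-- RULE D (μ₄, M) holds at the `N`-heads of chunk 35∕61. [kernel `decide`] -/
theorem ruleDN_35 : ∀ Z ∈ lN_35, RuleDMu4N cfg Z := by decide +kernel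
/-- RULE D (μ₄, M) holds at the `N`-heads of chunk 36∕61. [kernel `decide`] -/
theorem ruleDN_36 : ∀ Z ∈ lN_36, RuleDMu4N cfg Z := by decide +kernel
/-- RULE D (μ₄, M) holds at the `N`-heads of chunk 37∕61. [kernel `decide`] -/
theorem ruleDN_37 : ∀ Z ∈ lN_37, RuleDMu4N cfg Z := by decide +kernel


end Summit.Ventures.HSemireg.Pad4Tower.LineDesignCert12
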